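import Summits.BirchSwinnertonDyer.BirchSwinnertonDyer.Theses.ShaPrimaryTransfer
import Summits.BirchSwinnertonDyer.BirchSwinnertonDyer.Theses.TangentCone
import Summits.BirchSwinnertonDyer.BirchSwinnertonDyer.Theorems.SelmerRankShaCorank
import Literature.NumberTheory.EllipticCurves.IwasawaLeadingTermProofs
import Literature.NumberTheory.EllipticCurves.LeadingTerm
import Literature.NumberTheory.EllipticCurves.BSDSha
import Literature.NumberTheory.EllipticCurves.BSDSelmer

/-!
# BirchSwinnertonDyer / ShaPrimaryTransfer — crux `FiniteShaComponentTransfer` (stmt-BirchSwinnertonDyer-22356):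
# reading, the kernel, domination, the proved slice below analytic rank 2, parity, counterexample shape

Route `ShaPrimaryTransfer` (D-0145 LINE 2) replaces KatoTransfer's X1 («`corank Ш(E)[p^∞] = 0` at ONE good
ordinary `p ≥ 5`») by the pair T = `FiniteShaComponentTransfer` («`t_p(E) = 0 → t_q(E) = 0` for all primes
`p, q`», `t_p(E) = corank_{ℤ_p} Ш(E)[p^∞] = W.shaCorank p`) and O = `OneFiniteShaComponent` («some prime `p₀`
with `t_{p₀}(E) = 0`»). This helper file (prover seat `bsd-line-spt-p1`, `--supports stmt-22356 --as helper`;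
the registered skeleton is `Cruxes/FiniteShaComponentTransfer` line `gzk_split`, attached to the item) lands
the UNCONDITIONAL bookkeeping around T — every statement below is proved over the tree, the two deep inputs
(Gross–Zagier–Kolyvagin, the `p`-parity theorem) entering only as explicit named-fact HYPOTHESES where used:

* §1 READING. `t_p(E) = 0 ↔ Ш(E)[p^∞]` finite is a tree theorem
  (`finite_primaryComponent_sha_iff_shaCorank_eq_zero`: `Ш(E)[p]` is finite by weak Mordell–Weil), so T is
  verbatim «`Ш(E)[p^∞]` finite for one prime ⟹ for every prime» (`finiteShaComponentTransfer_iff_finite`) and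
  O is «some `Ш(E)[p₀^∞]` is finite» (`oneFiniteShaComponent_iff_finite`).
* §2 THE KERNEL IS stmt-0132. `T ∧ O ↔ ∀ E ∀ q, t_q(E) = 0 ↔ TangentCone.SelmerRankShaPFinite` (stmt-0132,
  «`Ш(E)[p^∞]` finite for every `E/ℚ` and every `p`»): the split T/O of the route is, JOINTLY, exactly the
  existing registered crux; separately each of T, O is a consequence of it
  (`transfer_and_door_iff_forall_shaCorank_eq_zero`, `transfer_and_door_iff_selmerRankShaPFinite`).
* §3 DOMINATION. `ShaFiniteConjecture → T`, `→ O` (bsd.S02; a counterexample to T is a counterexample to the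
  Tate–Shafarevich conjecture with TWO primary components of different type — none is known).
* §4 THE PROVED SLICE. `Ш(E/ℚ)` finite ⟹ every `t_q(E) = 0`; hence, granting Gross–Zagier–Kolyvagin
  (named fact `rank_eq_analyticRank_of_analyticRank_le_one`: `ord_{s=1} L ≤ 1 ⟹ rank = ord ∧ Ш finite`),
  T holds on `ord_{s=1} L(E,s) ≤ 1` with an idle hypothesis (`transfer_of_analyticRank_le_one`), the skeleton's
  stub 1 follows (`stub_kolyvaginFiniteSha_of_GZK`), and T is EQUIVALENT to its restriction to
  `ord_{s=1} L(E,s) ≥ 2` — the skeleton's open stub 2 (`finiteShaComponentTransfer_iff_kernel_of_GZK`).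
* §5 PARITY — the only cross-prime theorem at analytic rank ≥ 2. Granting the `p`-parity theorem at `p` and
  at `q` (named fact `p_parity W ·`: `(-1)^{s_p} = w(E)`, Dokchitser–Dokchitser 2010 Thm. 1.4),
  `t_p(E) ≡ t_q(E) (mod 2)` (`shaCorank_mod_two_eq_of_p_parity`); so `t_p(E) = 0` forces `t_q(E)` EVEN — T
  asks for `0`, and the gap `t_q(E) ∈ {2, 4, …}` is exactly what no instrument excludes.
* §6 COUNTEREXAMPLE SHAPE. `¬ T ↔ ∃ E p q, Ш(E)[p^∞] finite ∧ Ш(E)[q^∞] infinite`.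

Nothing here proves T, O or BSD; T is conjecture-grade at analytic rank ≥ 2 (first open cell: `ord L = 2`,
`t_2(E) = 0` by complete 2-descent, `q` good ordinary).

References: R. Greenberg, LNM 1716 (1999), §1 pp. 54–57; V. Kolyvagin, *Euler systems*, Grothendieck
Festschrift II (1990), Thm. A; B. Gross, D. Zagier, Invent. Math. 84 (1986); T. and V. Dokchitser, Ann. of
Math. 172 (2010), Thm. 1.4; J. Tate, Sém. Bourbaki 306 (1966) / J. Milne, Ann. of Math. 102 (1975) /
K. Kato, F. Trihan, Invent. Math. 153 (2003) (the function-field sibling, tree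
`forall_finite_primaryComponent_sha_of_exists_prime`).
-/

-- D-0017: single-problem summit, so `Summit.BirchSwinnertonDyer.BirchSwinnertonDyer.…` repeats a namespace BY DESIGN.
set_option linter.dupNamespace false

noncomputable section

namespace Summit.BirchSwinnertonDyer.BirchSwinnertonDyer.Theorems.ShaPrimaryTransferSlices

open scoped Classical
open Literature.NumberTheory.EllipticCurves
open Summit.BirchSwinnertonDyer.BirchSwinnertonDyer.Theses.ShaPrimaryTransfer
  (FiniteShaComponentTransfer OneFiniteShaComponent)
open Summit.BirchSwinnertonDyer.BirchSwinnertonDyer.Theses.TangentCone (SelmerRankShaPFinite)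

/-! ## §1 Reading: `t_p(E) = 0` is finiteness of `Ш(E)[p^∞]` -/

/-- T is, clause for clause, «for every elliptic `E/ℚ` and primes `p, q`: `Ш(E)[p^∞]` finite ⟹ `Ш(E)[q^∞]`
finite» (`t_p = 0 ↔ Ш[p^∞]` finite, tree theorem `finite_primaryComponent_sha_iff_shaCorank_eq_zero`,
because `Ш(E)[p]` is finite). [cite: Greenberg1999LNM, §1 pp. 54–57] -/
theorem finiteShaComponentTransfer_iff_finite :
    FiniteShaComponentTransfer ↔ ∀ (W : WeierstrassCurve ℚ) [W.IsElliptic] (p q : ℕ) [Fact p.Prime]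
      [Fact q.Prime], Finite ↥(AddCommGroup.primaryComponent W.sha p) →
        Finite ↥(AddCommGroup.primaryComponent W.sha q) := by
  constructor
  · intro h W _ p q _ _ hp
    exact (finite_primaryComponent_sha_iff_shaCorank_eq_zero W q).2
      (h W p q ((finite_primaryComponent_sha_iff_shaCorank_eq_zero W p).1 hp))
  · intro h W _ p q _ _ hp
    exact (finite_primaryComponent_sha_iff_shaCorank_eq_zero W q).1
      (h W p q ((finite_primaryComponent_sha_iff_shaCorank_eq_zero W p).2 hp))

/-- O is, clause for clause, «every elliptic `E/ℚ` has a prime `p₀` with `Ш(E)[p₀^∞]` finite».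
[cite: Greenberg1999LNM, §1 pp. 54–57] -/
theorem oneFiniteShaComponent_iff_finite :
    OneFiniteShaComponent ↔ ∀ (W : WeierstrassCurve ℚ) [W.IsElliptic],
      ∃ (p : ℕ) (_ : Fact p.Prime), Finite ↥(AddCommGroup.primaryComponent W.sha p) := by
  constructor
  · intro h W _
    obtain ⟨p, hp, h0⟩ := h W
    exact ⟨p, hp, (finite_primaryComponent_sha_iff_shaCorank_eq_zero W p).2 h0⟩
  · intro h W _
    obtain ⟨p, hp, h0⟩ := h W
    exact ⟨p, hp, (finite_primaryComponent_sha_iff_shaCorank_eq_zero W p).1 h0⟩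

/-! ## §2 The kernel of the route: T ∧ O is X1 at every prime, i.e. stmt-0132 -/

/-- **The kernel.** T ∧ O ⟺ every elliptic `E/ℚ` has `corank_{ℤ_q} Ш(E)[q^∞] = 0` at EVERY prime `q` (the
two lines of logic inside the route's deciding theorem, and their converse: T is implied because its
conclusion then always holds, O because any prime is a witness). [folklore] -/
theorem transfer_and_door_iff_forall_shaCorank_eq_zero :
    (FiniteShaComponentTransfer ∧ OneFiniteShaComponent) ↔
      ∀ (W : WeierstrassCurve ℚ) [W.IsElliptic] (q : ℕ) [Fact q.Prime], W.shaCorank q = 0 := by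
  constructor
  · rintro ⟨hT, hO⟩ W _ q _
    obtain ⟨p, hp, h0⟩ := hO W
    exact hT W p q h0
  · intro h
    refine ⟨fun W _ p q _ _ _ => h W q, fun W _ => ⟨2, ⟨Nat.prime_two⟩, ?_⟩⟩
    exact @h W _ 2 ⟨Nat.prime_two⟩

/-- **The kernel is the registered crux stmt-BirchSwinnertonDyer-0132.** T ∧ O ⟺
`TangentCone.SelmerRankShaPFinite` («`Ш(E)[p^∞]` is finite for every elliptic `E/ℚ` and every prime `p`»):
jointly the route's two new items are exactly that existing item; separately each is a consequence of it.
[cite: Greenberg1999LNM, §1 pp. 54–57] -/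
theorem transfer_and_door_iff_selmerRankShaPFinite :
    (FiniteShaComponentTransfer ∧ OneFiniteShaComponent) ↔ SelmerRankShaPFinite := by
  rw [transfer_and_door_iff_forall_shaCorank_eq_zero]
  constructor
  · intro h W _ p _
    exact (finite_primaryComponent_sha_iff_shaCorank_eq_zero W p).2 (h W p)
  · intro h W _ p _
    exact (finite_primaryComponent_sha_iff_shaCorank_eq_zero W p).1 (h W p)

/-- T alone is a consequence of stmt-0132. [folklore] -/
theorem finiteShaComponentTransfer_of_selmerRankShaPFinite (h : SelmerRankShaPFinite) :
    FiniteShaComponentTransfer :=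
  (transfer_and_door_iff_selmerRankShaPFinite.2 h).1

/-- O alone is a consequence of stmt-0132. [folklore] -/
theorem oneFiniteShaComponent_of_selmerRankShaPFinite (h : SelmerRankShaPFinite) :
    OneFiniteShaComponent :=
  (transfer_and_door_iff_selmerRankShaPFinite.2 h).2

/-! ## §3 Domination by the Tate–Shafarevich conjecture -/

/-- If `Ш(E/ℚ)` is finite then every `corank_{ℤ_q} Ш(E)[q^∞]` vanishes (a subgroup of a finite group is
finite; a finite `q`-primary group has corank `0`, Greenberg LNM 1716 §1, tree theorem
`Literature.BSD.shaCorank_eq_zero_of_finite`). [cite: Greenberg1999LNM, §1 pp. 54–57] -/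
theorem shaCorank_eq_zero_of_finite_sha (W : WeierstrassCurve ℚ) [W.IsElliptic] (hfin : Finite ↥W.sha)
    (q : ℕ) [Fact q.Prime] : W.shaCorank q = 0 :=
  Literature.BSD.shaCorank_eq_zero_of_finite W q (inferInstance : Finite ↥(AddCommGroup.primaryComponent W.sha q))

/-- `ShaFiniteConjecture` (bsd.S02, `Ш(E/ℚ)` finite for every elliptic `E/ℚ`) gives `t_q(E) = 0` for every
`E` and `q`. [cite: Greenberg1999LNM, §1 pp. 54–57] -/
theorem forall_shaCorank_eq_zero_of_shaFiniteConjecture (h : ShaFiniteConjecture) :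
    ∀ (W : WeierstrassCurve ℚ) [W.IsElliptic] (q : ℕ) [Fact q.Prime], W.shaCorank q = 0 :=
  fun W hW q _ => shaCorank_eq_zero_of_finite_sha W (h W hW) q

/-- T is WEAKER than the Tate–Shafarevich conjecture over `ℚ` (bsd.S02). [folklore] -/
theorem finiteShaComponentTransfer_of_shaFiniteConjecture (h : ShaFiniteConjecture) :
    FiniteShaComponentTransfer :=
  (transfer_and_door_iff_forall_shaCorank_eq_zero.2 (forall_shaCorank_eq_zero_of_shaFiniteConjecture h)).1

/-- O is WEAKER than the Tate–Shafarevich conjecture over `ℚ` (bsd.S02). [folklore] -/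
theorem oneFiniteShaComponent_of_shaFiniteConjecture (h : ShaFiniteConjecture) : OneFiniteShaComponent :=
  (transfer_and_door_iff_forall_shaCorank_eq_zero.2 (forall_shaCorank_eq_zero_of_shaFiniteConjecture h)).2

/-! ## §4 The proved slice: analytic rank ≤ 1 (Gross–Zagier–Kolyvagin), and the exact open residue -/

/-- **Transfer below analytic rank 2, per curve.** Granting Gross–Zagier–Kolyvagin (the tree's named fact
`rank_eq_analyticRank_of_analyticRank_le_one`: `ord_{s=1} L(E,s) ≤ 1 ⟹ rank E(ℚ) = ord ∧ Ш(E/ℚ)` finite;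
Kolyvagin 1990 Thm. A, Gross–Zagier 1986), a curve with `ord_{s=1} L(E,s) ≤ 1` has `t_q(E) = 0` at every
prime — so T holds for it, the hypothesis `t_p(E) = 0` being idle. CONDITIONAL on the named fact `hGZK`.
[cite: Kolyvagin1990, Thm. A] [cite: Darmon2004, Thm. 3.22] -/
theorem transfer_of_analyticRank_le_one (hGZK : rank_eq_analyticRank_of_analyticRank_le_one)
    (W : WeierstrassCurve ℚ) [W.IsElliptic] (p q : ℕ) [Fact p.Prime] [Fact q.Prime]
    (hr : W.analyticRank ≤ 1) (_hp : W.shaCorank p = 0) : W.shaCorank q = 0 :=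
  shaCorank_eq_zero_of_finite_sha W (hGZK W hr).2 q

/-- **Stub 1 of the skeleton `gzk_split` modulo the named fact.** Its registered signature
(`∀ W elliptic, ord_{s=1} L(E,s) ≤ 1 → Ш(E/ℚ)` finite) is the `Ш`-half of `rank_eq_analyticRank_of_analyticRank_le_one`;
recorded so that the day `…_holds` lands the stub closes by `stub_kolyvaginFiniteSha_of_GZK …_holds`.
CONDITIONAL on `hGZK`. [cite: Kolyvagin1990, Thm. A] -/
theorem stub_kolyvaginFiniteSha_of_GZK (hGZK : rank_eq_analyticRank_of_analyticRank_le_one) :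
    ∀ (W : WeierstrassCurve ℚ) [W.IsElliptic], W.analyticRank ≤ 1 → Finite ↥W.sha :=
  fun W _ hr => (hGZK W hr).2

/-- **The exact open residue.** Granting Gross–Zagier–Kolyvagin, T is EQUIVALENT to its restriction to
analytic rank ≥ 2 — verbatim the registered open stub `stub_transferOfTwoLeAnalyticRank` of the skeleton
`gzk_split`. Numbers, not adjectives: on that sector nothing is in print beyond parity (§5).
CONDITIONAL on `hGZK` (only the direction residue ⟹ T uses it). [cite: Kolyvagin1990, Thm. A]
[cite: DokchitserDokchitserAnnals2010, Thm. 1.4] -/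
theorem finiteShaComponentTransfer_iff_kernel_of_GZK (hGZK : rank_eq_analyticRank_of_analyticRank_le_one) :
    FiniteShaComponentTransfer ↔ ∀ (W : WeierstrassCurve ℚ) [W.IsElliptic] (p q : ℕ) [Fact p.Prime]
      [Fact q.Prime], 2 ≤ W.analyticRank → W.shaCorank p = 0 → W.shaCorank q = 0 := by
  constructor
  · intro h W _ p q _ _ _ hp
    exact h W p q hp
  · intro h W _ p q _ _ hp
    rcases Nat.lt_or_ge W.analyticRank 2 with hlt | hge
    · exact transfer_of_analyticRank_le_one hGZK W p q (by omega) hp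
    · exact h W p q hge hp

/-! ## §5 Parity: `t_p(E) ≡ t_q(E) (mod 2)` — the only cross-prime theorem at analytic rank ≥ 2 -/

/-- `(-1)^m = (-1)^n` in `ℤ` forces `m ≡ n (mod 2)`. [folklore] -/
theorem mod_two_eq_of_neg_one_pow_eq {m n : ℕ} (h : (-1 : ℤ) ^ m = (-1 : ℤ) ^ n) : m % 2 = n % 2 := by
  rcases Nat.even_or_odd m with hm | hm <;> rcases Nat.even_or_odd n with hn | hn
  · rw [Nat.even_iff.1 hm, Nat.even_iff.1 hn]
  · rw [hm.neg_one_pow, hn.neg_one_pow] at h; exact absurd h (by decide)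
  · rw [hm.neg_one_pow, hn.neg_one_pow] at h; exact absurd h (by decide)
  · rw [Nat.odd_iff.1 hm, Nat.odd_iff.1 hn]

/-- **Selmer coranks at two primes have the same parity**, granting the `p`-parity theorem at both primes
(named fact `p_parity W p : (-1)^{corank Sel_{p^∞}(E/ℚ)} = w(E)`, Dokchitser–Dokchitser 2010 Thm. 1.4, all
`E/ℚ`, all `p`): both signs equal the global root number. CONDITIONAL on `hp`, `hq`.
[cite: DokchitserDokchitserAnnals2010, Thm. 1.4] -/
theorem selmerCorank_mod_two_eq_of_p_parity (W : WeierstrassCurve ℚ) [W.IsElliptic] (p q : ℕ)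
    [Fact p.Prime] [Fact q.Prime] (hp : p_parity W p) (hq : p_parity W q) :
    W.selmerCorank p % 2 = W.selmerCorank q % 2 := by
  have h1 : (-1 : ℤ) ^ W.selmerCorank p = W.rootNumber := hp
  have h2 : (-1 : ℤ) ^ W.selmerCorank q = W.rootNumber := hq
  exact mod_two_eq_of_neg_one_pow_eq (h1.trans h2.symm)

/-- **`t_p(E) ≡ t_q(E) (mod 2)`**: the parity of `corank_{ℤ_p} Ш(E)[p^∞]` does not depend on `p`, granting the
`p`-parity theorem at `p` and `q` (Dokchitser–Dokchitser 2010 Thm. 1.4) — via Greenberg's identity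
`corank Sel_{p^∞} = rank + corank Ш[p^∞]` (tree theorem `selmerCorank_eq_mordellWeilRank_add_holds`), the
rank term being `p`-free. This is the whole of what is in print towards T at analytic rank ≥ 2.
CONDITIONAL on `hp`, `hq`. [cite: DokchitserDokchitserAnnals2010, Thm. 1.4] [cite: Greenberg1999LNM, §1 pp. 54–57] -/
theorem shaCorank_mod_two_eq_of_p_parity (W : WeierstrassCurve ℚ) [W.IsElliptic] (p q : ℕ)
    [Fact p.Prime] [Fact q.Prime] (hp : p_parity W p) (hq : p_parity W q) :
    W.shaCorank p % 2 = W.shaCorank q % 2 := by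
  have hs := selmerCorank_mod_two_eq_of_p_parity W p q hp hq
  have e1 : W.selmerCorank p = W.mordellWeilRank + W.shaCorank p :=
    W.selmerCorank_eq_mordellWeilRank_add_holds p
  have e2 : W.selmerCorank q = W.mordellWeilRank + W.shaCorank q :=
    W.selmerCorank_eq_mordellWeilRank_add_holds q
  omega

/-- **The parity shadow of T.** Granting `p`-parity at `p` and `q`: `t_p(E) = 0 ⟹ t_q(E)` is even. T asks
for `t_q(E) = 0`; the residue `t_q(E) ∈ {2, 4, …}` (an even number of copies of `ℚ_q/ℤ_q` in `Ш(E)`) is what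
no theorem excludes at analytic rank ≥ 2. CONDITIONAL on `hp`, `hq`. [cite: DokchitserDokchitserAnnals2010, Thm. 1.4] -/
theorem even_shaCorank_of_shaCorank_eq_zero_of_p_parity (W : WeierstrassCurve ℚ) [W.IsElliptic]
    (p q : ℕ) [Fact p.Prime] [Fact q.Prime] (hp : p_parity W p) (hq : p_parity W q)
    (h0 : W.shaCorank p = 0) : Even (W.shaCorank q) := by
  have h := shaCorank_mod_two_eq_of_p_parity W p q hp hq
  rw [h0] at h
  exact Nat.even_iff.2 h.symm

/-- The same parity transfer from the ANALYTIC form of `p`-parity (named fact `selmerCorank_mod_two_eq W ·`: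
`corank Sel_{p^∞} ≡ ord_{s=1} L(E,s) (mod 2)`) at `p` and `q`. CONDITIONAL on `hp`, `hq`.
[cite: DokchitserDokchitserAnnals2010, Thm. 1.4] -/
theorem shaCorank_mod_two_eq_of_selmerCorank_mod_two_eq (W : WeierstrassCurve ℚ) [W.IsElliptic]
    (p q : ℕ) [Fact p.Prime] [Fact q.Prime] (hp : selmerCorank_mod_two_eq W p)
    (hq : selmerCorank_mod_two_eq W q) : W.shaCorank p % 2 = W.shaCorank q % 2 := by
  have h1 : W.selmerCorank p % 2 = W.analyticRank % 2 := hp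
  have h2 : W.selmerCorank q % 2 = W.analyticRank % 2 := hq
  have e1 : W.selmerCorank p = W.mordellWeilRank + W.shaCorank p :=
    W.selmerCorank_eq_mordellWeilRank_add_holds p
  have e2 : W.selmerCorank q = W.mordellWeilRank + W.shaCorank q :=
    W.selmerCorank_eq_mordellWeilRank_add_holds q
  omega

/-! ## §6 Counterexample shape -/

/-- **What a refutation of T is.** `¬ T` ⟺ some elliptic `E/ℚ` has a FINITE `p`-primary part and an INFINITE
`q`-primary part of `Ш` — two primary components of different type; in particular a counterexample to the
Tate–Shafarevich conjecture, certified infinite at `q` (no instrument certifies `t_q > 0`). [folklore] -/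
theorem not_finiteShaComponentTransfer_iff :
    ¬ FiniteShaComponentTransfer ↔ ∃ (W : WeierstrassCurve ℚ) (_ : W.IsElliptic) (p q : ℕ)
      (_ : Fact p.Prime) (_ : Fact q.Prime), Finite ↥(AddCommGroup.primaryComponent W.sha p) ∧
        Infinite ↥(AddCommGroup.primaryComponent W.sha q) := by
  rw [finiteShaComponentTransfer_iff_finite]
  constructor
  · intro h
    by_contra hne
    apply h
    intro W _ p q _ _ hp
    by_contra hq
    exact hne ⟨W, ‹_›, p, q, ‹_›, ‹_›, hp, not_finite_iff_infinite.1 hq⟩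
  · rintro ⟨W, hW, p, q, hp', hq', hp, hq⟩ h
    exact not_finite_iff_infinite.2 hq (@h W hW p q hp' hq' hp)

end Summit.BirchSwinnertonDyer.BirchSwinnertonDyer.Theorems.ShaPrimaryTransferSlices
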